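import Summits.CriticalPhenomena.PercolationContinuityZ3.Theorems.PercNearOneGluingNoHeavyConstsTwoCopyDownwardFKG
import HarnessLib

/-!
# The hard-core pair of two downward-FKG laws — abstract finite core, part III: negative correlation across the copies,
# "same copy beats cross copy", and the symmetric forms

Support file (prover prim-facecert gen 14; `--supports stmt-CriticalPhenomena-4575`); builds on the lead seat
prim-nh-lead-4575's gen-105 programme (memo `run/shared/lean/prim/prim-nh-lead-4575/LEAD-GEN105.md` §1(6): conjecture (HC)
"hard-core Harris", its reduction to PA-BERN = `Consts.FibrewiseBHK`, and the pencil proof of the MEASURE-LEVEL two-copy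
statement by an averaging-operator iteration; `|N| = 1` in the kernel: `…ConstsHardCoreHarrisOne`).  No definitions, no named
facts, no sorries; standard axioms.

From `TwoCopyHardCore.assoc` (part II):
* `negCorr` — a monotone function of copy 0 and a monotone function of copy 1 are NEGATIVELY correlated under the pair weight
  (`ΣΣ pp'κ F a G b · ΣΣ pp'κ ≤ ΣΣ pp'κ F a · ΣΣ pp'κ G b`): `ΣΣ pp'κ F a G b = Σ ν₀ F·(T'G)` with `T'G` antitone;
* `sameCopy_ge_crossCopy` — the abstract HARD-CORE HARRIS inequality in the symmetric setting (`α = β`, `p = p'`, `κ`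
  symmetric): `ΣΣ ppκ·F a·G b ≤ ΣΣ ppκ·F a·G a` (`G − TG` is monotone with pair-mean zero);
* `assoc_symm`, `negCorr_symm` — the symmetric one-type forms used by the percolation files
  (`…ConstsHardCoreHarrisMeasure`).  [this work]
-/

namespace Summit.CriticalPhenomena.PercolationContinuityZ3.Theorems

namespace TwoCopyHardCore

open Finset

variable {α β : Type*} [Fintype α] [Fintype β]

section TwoCopies

variable [Preorder α] [Preorder β]

/-- **Two-copy negative correlation across the copies (abstract form).**  Under the hypotheses of `assoc`, a monotone
function of the copy-0 coordinate and a monotone function of the copy-1 coordinate are NEGATIVELY correlated under the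
pair weight `p a · p' b · κ a b`:  `(ΣΣ pp'κ·F a G b)(ΣΣ pp'κ) ≤ (ΣΣ pp'κ·F a)(ΣΣ pp'κ·G b)`.
Proof: `ΣΣ pp'κ F a G b = ΣΣ pp'κ F a (T'G) a` with the conditional average `T'G` of `G`, which is antitone
(`transfer_antitone`); then `assoc` for `F` and `−T'G`.  [this work] -/
theorem negCorr (p : α → ℝ) (p' : β → ℝ) (κ : α → β → ℝ)
    (hp : ∀ a, 0 ≤ p a) (hp' : ∀ b, 0 ≤ p' b)
    (hκ01 : ∀ a b, κ a b = 0 ∨ κ a b = 1)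
    (hκa : ∀ b, Antitone (fun a => κ a b)) (hκb : ∀ a, Antitone (κ a))
    (hPA₀ : ∀ b (F G : α → ℝ), Monotone F → Monotone G →
      (∑ a, p a * κ a b * F a) * (∑ a, p a * κ a b * G a) ≤
        (∑ a, p a * κ a b) * (∑ a, p a * κ a b * (F a * G a)))
    (hPA₁ : ∀ a (F G : β → ℝ), Monotone F → Monotone G →
      (∑ b, p' b * κ a b * F b) * (∑ b, p' b * κ a b * G b) ≤
        (∑ b, p' b * κ a b) * (∑ b, p' b * κ a b * (F b * G b)))
    (B₀ : Finset α) (hB₀ : ∀ a ∈ B₀, ∀ b, κ a b = 1) (hB₀pos : 0 < ∑ a ∈ B₀, p a)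
    (B₁ : Finset β) (hB₁ : ∀ b ∈ B₁, ∀ a, κ a b = 1) (hB₁pos : 0 < ∑ b ∈ B₁, p' b)
    (F : α → ℝ) (G : β → ℝ) (hF : Monotone F) (hG : Monotone G) :
    (∑ a, ∑ b, p a * p' b * κ a b * (F a * G b)) * (∑ a, ∑ b, p a * p' b * κ a b) ≤
      (∑ a, ∑ b, p a * p' b * κ a b * F a) * (∑ a, ∑ b, p a * p' b * κ a b * G b) := by
  classical
  have hκ0 : ∀ a b, 0 ≤ κ a b := fun a b => by rcases hκ01 a b with h | h <;> norm_num [h]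
  -- the conditional average of `G` given the copy-0 coordinate
  set m₁ : α → ℝ := fun a => ∑ b, p' b * κ a b with hm₁def
  have hm₁ : ∀ a, m₁ a = ∑ b, p' b * (fun b a => κ a b) b a := fun a => rfl
  have hm₁pos : ∀ a, 0 < m₁ a := by
    intro a
    calc (0 : ℝ) < ∑ b ∈ B₁, p' b := hB₁pos
      _ = ∑ b ∈ B₁, p' b * κ a b := Finset.sum_congr rfl fun b hb => by rw [hB₁ b hb a, mul_one]
      _ ≤ ∑ b, p' b * κ a b :=
          Finset.sum_le_sum_of_subset_of_nonneg (Finset.subset_univ _) fun b _ _ => mul_nonneg (hp' b) (hκ0 a b)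
  set TG : α → ℝ := fun a => (∑ b, p' b * κ a b * G b) / m₁ a with hTGdef
  have hTG : ∀ a, TG a * m₁ a = ∑ b, p' b * (fun b a => κ a b) b a * G b := fun a => by
    simp only [hTGdef]; exact div_mul_cancel₀ _ (ne_of_gt (hm₁pos a))
  have hTGanti : Antitone TG :=
    transfer_antitone p' (fun b a => κ a b) G m₁ TG (fun b a => hκ01 a b) (fun a => hκb a) (fun b => hκa b)
      hm₁ hm₁pos hTG (fun a h k hh hk => hPA₁ a h k hh hk) hG
  -- `assoc` for `F` and `−TG`
  have hA := assoc p p' κ hp hp' hκ01 hκa hκb hPA₀ hPA₁ B₀ hB₀ hB₀pos B₁ hB₁ hB₁pos F (fun a => -TG a)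
    hF hTGanti.neg
  -- identification of the sums
  have e1 : ∀ a, ∑ b, p a * p' b * κ a b * (F a * G b) = ∑ b, p a * p' b * κ a b * (F a * TG a) := by
    intro a
    have h1 : ∑ b, p a * p' b * κ a b * (F a * G b) = p a * F a * (∑ b, p' b * κ a b * G b) := by
      rw [Finset.mul_sum]; exact Finset.sum_congr rfl fun b _ => by ring
    have h2 : ∑ b, p a * p' b * κ a b * (F a * TG a) = p a * F a * (TG a * m₁ a) := by
      rw [hm₁ a, Finset.mul_sum, Finset.mul_sum]; exact Finset.sum_congr rfl fun b _ => by ring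
    rw [h1, h2, hTG a]
  have e2 : ∀ a, ∑ b, p a * p' b * κ a b * G b = ∑ b, p a * p' b * κ a b * TG a := by
    intro a
    have h1 : ∑ b, p a * p' b * κ a b * G b = p a * (∑ b, p' b * κ a b * G b) := by
      rw [Finset.mul_sum]; exact Finset.sum_congr rfl fun b _ => by ring
    have h2 : ∑ b, p a * p' b * κ a b * TG a = p a * (TG a * m₁ a) := by
      rw [hm₁ a, Finset.mul_sum, Finset.mul_sum]; exact Finset.sum_congr rfl fun b _ => by ring
    rw [h1, h2, hTG a]
  have e3 : ∑ a, ∑ b, p a * p' b * κ a b * (F a * G b) = ∑ a, ∑ b, p a * p' b * κ a b * (F a * TG a) :=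
    Finset.sum_congr rfl fun a _ => e1 a
  have e4 : ∑ a, ∑ b, p a * p' b * κ a b * G b = ∑ a, ∑ b, p a * p' b * κ a b * TG a :=
    Finset.sum_congr rfl fun a _ => e2 a
  have e5 : ∑ a, ∑ b, p a * p' b * κ a b * (-TG a) = -∑ a, ∑ b, p a * p' b * κ a b * TG a := by
    rw [← Finset.sum_neg_distrib]
    exact Finset.sum_congr rfl fun a _ => by
      rw [← Finset.sum_neg_distrib]; exact Finset.sum_congr rfl fun b _ => by ring
  have e6 : ∑ a, ∑ b, p a * p' b * κ a b * (F a * -TG a) = -∑ a, ∑ b, p a * p' b * κ a b * (F a * TG a) := by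
    rw [← Finset.sum_neg_distrib]
    exact Finset.sum_congr rfl fun a _ => by
      rw [← Finset.sum_neg_distrib]; exact Finset.sum_congr rfl fun b _ => by ring
  rw [e5, e6] at hA
  rw [e3, e4]
  nlinarith [hA]

/-- **Hard-core Harris (abstract, symmetric form).**  One finite (pre)ordered type with nonnegative weights `p`, a
SYMMETRIC `0/1` compatibility kernel `κ` antitone in each argument, conditional positive association given each
partner, and a bottom of positive weight.  Then for monotone `F, G`, under the pair weight `p a · p b · κ a b`,
"same copy beats cross copy":  `ΣΣ ppκ · F a · G b ≤ ΣΣ ppκ · F a · G a`.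
Proof: with the conditional average `TG` (antitone), `G − TG` is monotone and has pair-mean zero by symmetry, so
`assoc (F, G − TG)` gives `ΣΣ ppκ F (G − TG) ≥ 0`, and `ΣΣ ppκ F a (TG a) = ΣΣ ppκ F a G b`.  [this work] -/
theorem sameCopy_ge_crossCopy (p : α → ℝ) (κ : α → α → ℝ)
    (hp : ∀ a, 0 ≤ p a) (hκ01 : ∀ a b, κ a b = 0 ∨ κ a b = 1)
    (hκsymm : ∀ a b, κ a b = κ b a) (hκa : ∀ b, Antitone (fun a => κ a b))
    (hPA : ∀ b (F G : α → ℝ), Monotone F → Monotone G →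
      (∑ a, p a * κ a b * F a) * (∑ a, p a * κ a b * G a) ≤
        (∑ a, p a * κ a b) * (∑ a, p a * κ a b * (F a * G a)))
    (B₀ : Finset α) (hB₀ : ∀ a ∈ B₀, ∀ b, κ a b = 1) (hB₀pos : 0 < ∑ a ∈ B₀, p a)
    (F G : α → ℝ) (hF : Monotone F) (hG : Monotone G) :
    ∑ a, ∑ b, p a * p b * κ a b * (F a * G b) ≤ ∑ a, ∑ b, p a * p b * κ a b * (F a * G a) := by
  classical
  have hκ0 : ∀ a b, 0 ≤ κ a b := fun a b => by rcases hκ01 a b with h | h <;> norm_num [h]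
  have hκb : ∀ a, Antitone (κ a) := fun a b b' hbb' => by
    rw [hκsymm a b, hκsymm a b']; exact hκa a hbb'
  have hB₀' : ∀ b ∈ B₀, ∀ a, κ a b = 1 := fun b hb a => by rw [hκsymm]; exact hB₀ b hb a
  have hPA' : ∀ a (F G : α → ℝ), Monotone F → Monotone G →
      (∑ b, p b * κ a b * F b) * (∑ b, p b * κ a b * G b) ≤
        (∑ b, p b * κ a b) * (∑ b, p b * κ a b * (F b * G b)) := by
    intro a F G hF hG
    have h := hPA a F G hF hG
    simp only [hκsymm _ a] at h
    exact h
  -- the conditional average of `G`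
  set m : α → ℝ := fun a => ∑ b, p b * κ a b with hmdef
  have hm : ∀ a, m a = ∑ b, p b * (fun b a => κ a b) b a := fun a => rfl
  have hmge : ∀ a, ∑ b ∈ B₀, p b ≤ m a := by
    intro a
    calc ∑ b ∈ B₀, p b = ∑ b ∈ B₀, p b * κ a b :=
          Finset.sum_congr rfl fun b hb => by rw [hB₀' b hb a, mul_one]
      _ ≤ ∑ b, p b * κ a b :=
          Finset.sum_le_sum_of_subset_of_nonneg (Finset.subset_univ _) fun b _ _ => mul_nonneg (hp b) (hκ0 a b)
  have hmpos : ∀ a, 0 < m a := fun a => lt_of_lt_of_le hB₀pos (hmge a)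
  set TG : α → ℝ := fun a => (∑ b, p b * κ a b * G b) / m a with hTGdef
  have hTG : ∀ a, TG a * m a = ∑ b, p b * (fun b a => κ a b) b a * G b := fun a => by
    simp only [hTGdef]; exact div_mul_cancel₀ _ (ne_of_gt (hmpos a))
  have hTGanti : Antitone TG :=
    transfer_antitone p (fun b a => κ a b) G m TG (fun b a => hκ01 a b) (fun a => hκb a) (fun b => hκa b)
      hm hmpos hTG (fun a h k hh hk => hPA' a h k hh hk) hG
  -- `assoc` for `F` and `G − TG`
  have hA := assoc p p κ hp hp hκ01 hκa hκb hPA hPA' B₀ hB₀ hB₀pos B₀ hB₀' hB₀pos F (fun a => G a - TG a)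
    hF (hG.add hTGanti.neg)
  -- `ΣΣ ppκ·TG a = ΣΣ ppκ·G b = ΣΣ ppκ·G a`
  have e2 : ∀ a, ∑ b, p a * p b * κ a b * G b = ∑ b, p a * p b * κ a b * TG a := by
    intro a
    have h1 : ∑ b, p a * p b * κ a b * G b = p a * (∑ b, p b * κ a b * G b) := by
      rw [Finset.mul_sum]; exact Finset.sum_congr rfl fun b _ => by ring
    have h2 : ∑ b, p a * p b * κ a b * TG a = p a * (TG a * m a) := by
      rw [hm a, Finset.mul_sum, Finset.mul_sum]; exact Finset.sum_congr rfl fun b _ => by ring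
    rw [h1, h2, hTG a]
  have eT : ∑ a, ∑ b, p a * p b * κ a b * TG a = ∑ a, ∑ b, p a * p b * κ a b * G a := by
    rw [show ∑ a, ∑ b, p a * p b * κ a b * TG a = ∑ a, ∑ b, p a * p b * κ a b * G b from
      Finset.sum_congr rfl fun a _ => (e2 a).symm, Finset.sum_comm]
    exact Finset.sum_congr rfl fun a _ => Finset.sum_congr rfl fun b _ => by rw [hκsymm b a]; ring
  have eX : ∑ a, ∑ b, p a * p b * κ a b * (G a - TG a) = 0 := by
    have : ∑ a, ∑ b, p a * p b * κ a b * (G a - TG a) =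
        ∑ a, ∑ b, p a * p b * κ a b * G a - ∑ a, ∑ b, p a * p b * κ a b * TG a := by
      rw [← Finset.sum_sub_distrib]
      exact Finset.sum_congr rfl fun a _ => by
        rw [← Finset.sum_sub_distrib]; exact Finset.sum_congr rfl fun b _ => by ring
    rw [this, eT, sub_self]
  -- `ΣΣ ppκ·F a·TG a = ΣΣ ppκ·F a·G b`
  have e1 : ∀ a, ∑ b, p a * p b * κ a b * (F a * G b) = ∑ b, p a * p b * κ a b * (F a * TG a) := by
    intro a
    have h1 : ∑ b, p a * p b * κ a b * (F a * G b) = p a * F a * (∑ b, p b * κ a b * G b) := by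
      rw [Finset.mul_sum]; exact Finset.sum_congr rfl fun b _ => by ring
    have h2 : ∑ b, p a * p b * κ a b * (F a * TG a) = p a * F a * (TG a * m a) := by
      rw [hm a, Finset.mul_sum, Finset.mul_sum]; exact Finset.sum_congr rfl fun b _ => by ring
    rw [h1, h2, hTG a]
  have eFX : ∑ a, ∑ b, p a * p b * κ a b * (F a * (G a - TG a)) =
      ∑ a, ∑ b, p a * p b * κ a b * (F a * G a) - ∑ a, ∑ b, p a * p b * κ a b * (F a * G b) := by
    rw [← Finset.sum_sub_distrib]
    exact Finset.sum_congr rfl fun a _ => by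
      rw [e1 a, ← Finset.sum_sub_distrib]; exact Finset.sum_congr rfl fun b _ => by ring
  rw [eX, eFX, mul_zero] at hA
  -- the total mass is positive
  have hQpos : 0 < ∑ a, ∑ b, p a * p b * κ a b := by
    have h1 : (∑ a ∈ B₀, p a) * (∑ b ∈ B₀, p b) ≤ ∑ a, ∑ b, p a * p b * κ a b :=
      calc (∑ a ∈ B₀, p a) * (∑ b ∈ B₀, p b) = ∑ a ∈ B₀, p a * ∑ b ∈ B₀, p b := Finset.sum_mul _ _ _
        _ ≤ ∑ a ∈ B₀, p a * m a :=
            Finset.sum_le_sum fun a _ => mul_le_mul_of_nonneg_left (hmge a) (hp a)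
        _ ≤ ∑ a, p a * m a :=
            Finset.sum_le_sum_of_subset_of_nonneg (Finset.subset_univ _) fun a _ _ =>
              mul_nonneg (hp a) (hmpos a).le
        _ = ∑ a, ∑ b, p a * p b * κ a b :=
            Finset.sum_congr rfl fun a _ => by
              rw [Finset.mul_sum]; exact Finset.sum_congr rfl fun b _ => by ring
    exact lt_of_lt_of_le (mul_pos hB₀pos hB₀pos) h1
  nlinarith [hA, hQpos]

/-- `assoc` in the symmetric one-type setting (both copies have the same weights `p` and the kernel is symmetric):
the hypotheses for the second copy are derived from those for the first. [this work] -/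
theorem assoc_symm (p : α → ℝ) (κ : α → α → ℝ)
    (hp : ∀ a, 0 ≤ p a) (hκ01 : ∀ a b, κ a b = 0 ∨ κ a b = 1)
    (hκsymm : ∀ a b, κ a b = κ b a) (hκa : ∀ b, Antitone (fun a => κ a b))
    (hPA : ∀ b (F G : α → ℝ), Monotone F → Monotone G →
      (∑ a, p a * κ a b * F a) * (∑ a, p a * κ a b * G a) ≤
        (∑ a, p a * κ a b) * (∑ a, p a * κ a b * (F a * G a)))
    (B₀ : Finset α) (hB₀ : ∀ a ∈ B₀, ∀ b, κ a b = 1) (hB₀pos : 0 < ∑ a ∈ B₀, p a)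
    (F G : α → ℝ) (hF : Monotone F) (hG : Monotone G) :
    (∑ a, ∑ b, p a * p b * κ a b * F a) * (∑ a, ∑ b, p a * p b * κ a b * G a) ≤
      (∑ a, ∑ b, p a * p b * κ a b) * (∑ a, ∑ b, p a * p b * κ a b * (F a * G a)) := by
  have hκb : ∀ a, Antitone (κ a) := fun a b b' hbb' => by
    rw [hκsymm a b, hκsymm a b']; exact hκa a hbb'
  have hB₀' : ∀ b ∈ B₀, ∀ a, κ a b = 1 := fun b hb a => by rw [hκsymm]; exact hB₀ b hb a
  have hPA' : ∀ a (F G : α → ℝ), Monotone F → Monotone G →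
      (∑ b, p b * κ a b * F b) * (∑ b, p b * κ a b * G b) ≤
        (∑ b, p b * κ a b) * (∑ b, p b * κ a b * (F b * G b)) := by
    intro a F G hF hG
    have h := hPA a F G hF hG
    simp only [hκsymm _ a] at h
    exact h
  exact assoc p p κ hp hp hκ01 hκa hκb hPA hPA' B₀ hB₀ hB₀pos B₀ hB₀' hB₀pos F G hF hG

/-- `negCorr` in the symmetric one-type setting. [this work] -/
theorem negCorr_symm (p : α → ℝ) (κ : α → α → ℝ)
    (hp : ∀ a, 0 ≤ p a) (hκ01 : ∀ a b, κ a b = 0 ∨ κ a b = 1)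
    (hκsymm : ∀ a b, κ a b = κ b a) (hκa : ∀ b, Antitone (fun a => κ a b))
    (hPA : ∀ b (F G : α → ℝ), Monotone F → Monotone G →
      (∑ a, p a * κ a b * F a) * (∑ a, p a * κ a b * G a) ≤
        (∑ a, p a * κ a b) * (∑ a, p a * κ a b * (F a * G a)))
    (B₀ : Finset α) (hB₀ : ∀ a ∈ B₀, ∀ b, κ a b = 1) (hB₀pos : 0 < ∑ a ∈ B₀, p a)
    (F G : α → ℝ) (hF : Monotone F) (hG : Monotone G) :
    (∑ a, ∑ b, p a * p b * κ a b * (F a * G b)) * (∑ a, ∑ b, p a * p b * κ a b) ≤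
      (∑ a, ∑ b, p a * p b * κ a b * F a) * (∑ a, ∑ b, p a * p b * κ a b * G b) := by
  have hκb : ∀ a, Antitone (κ a) := fun a b b' hbb' => by
    rw [hκsymm a b, hκsymm a b']; exact hκa a hbb'
  have hB₀' : ∀ b ∈ B₀, ∀ a, κ a b = 1 := fun b hb a => by rw [hκsymm]; exact hB₀ b hb a
  have hPA' : ∀ a (F G : α → ℝ), Monotone F → Monotone G →
      (∑ b, p b * κ a b * F b) * (∑ b, p b * κ a b * G b) ≤
        (∑ b, p b * κ a b) * (∑ b, p b * κ a b * (F b * G b)) := by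
    intro a F G hF hG
    have h := hPA a F G hF hG
    simp only [hκsymm _ a] at h
    exact h
  exact negCorr p p κ hp hp hκ01 hκa hκb hPA hPA' B₀ hB₀ hB₀pos B₀ hB₀' hB₀pos F G hF hG

end TwoCopies


end TwoCopyHardCore

end Summit.CriticalPhenomena.PercolationContinuityZ3.Theorems
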